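import Summits.QuantumFields.GaugeBoot.Rows.GLYZc2D4HTab
import HarnessLib

/-!
# Gauge-boot: kernel check of the raw `H` class table of the glyz-c2-4D problems, rows 304–337 (part 17/20)

Cell `pub-gaugeboot` (HOME `run/shared/lean/pub/pub-gaugeboot/`), seat lean1 (torus layer for rows C76–C87 = the certified
glyz-c2-4D windows: label set, raw blocks, class/witness tables, the reduction identity, per-β bindings).

HONEST FRAMING (page 1 of every file of this cell): certified bounds on lattice expectations at STATED coupling,
gauge group, dimension and torus size; NOT a mass gap, NOT a continuum limit, NOT a string tension, NOT large `N`.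
The venture is explicitly NOT Yang–Mills-summit-bearing (barriers `FixedCouplingUltralocality`,
`PerturbativeInvisibility`).

`hcanon_rows_<lo>_<hi> : ∀ i, lo ≤ i < hi → ∀ j ≥ i, GLYZc2D4.HCanonOK i j`, each range one closed computation (`decide +kernel`);
assembled in `GLYZc2D4Canon`.
-/

noncomputable section

open Literature.MathematicalPhysics.QuantumFieldTheory

namespace Summit.QuantumFields.GaugeBoot

namespace GLYZc2D4

set_option maxHeartbeats 0 in
/-- Rows `304 ≤ i < 310` of the `H` class table of the glyz-c2-4D problems canonicalise (1155 entries; kernel). -/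
theorem hcanon_rows_304_310 : ∀ i : Fin 499, 304 ≤ i.val → i.val < 310 → ∀ j : Fin 499, i.val ≤ j.val → GLYZc2D4.HCanonOK i j := by
  decide +kernel

set_option maxHeartbeats 0 in
/-- Rows `310 ≤ i < 317` of the `H` class table of the glyz-c2-4D problems canonicalise (1302 entries; kernel). -/
theorem hcanon_rows_310_317 : ∀ i : Fin 499, 310 ≤ i.val → i.val < 317 → ∀ j : Fin 499, i.val ≤ j.val → GLYZc2D4.HCanonOK i j := by
  decide +kernel

set_option maxHeartbeats 0 in
/-- Rows `317 ≤ i < 324` of the `H` class table of the glyz-c2-4D problems canonicalise (1253 entries; kernel). -/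
theorem hcanon_rows_317_324 : ∀ i : Fin 499, 317 ≤ i.val → i.val < 324 → ∀ j : Fin 499, i.val ≤ j.val → GLYZc2D4.HCanonOK i j := by
  decide +kernel

set_option maxHeartbeats 0 in
/-- Rows `324 ≤ i < 331` of the `H` class table of the glyz-c2-4D problems canonicalise (1204 entries; kernel). -/
theorem hcanon_rows_324_331 : ∀ i : Fin 499, 324 ≤ i.val → i.val < 331 → ∀ j : Fin 499, i.val ≤ j.val → GLYZc2D4.HCanonOK i j := by
  decide +kernel

set_option maxHeartbeats 0 in
/-- Rows `331 ≤ i < 338` of the `H` class table of the glyz-c2-4D problems canonicalise (1155 entries; kernel). -/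
theorem hcanon_rows_331_338 : ∀ i : Fin 499, 331 ≤ i.val → i.val < 338 → ∀ j : Fin 499, i.val ≤ j.val → GLYZc2D4.HCanonOK i j := by
  decide +kernel

end GLYZc2D4

end Summit.QuantumFields.GaugeBoot

end
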